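import Mathlib.MeasureTheory.Integral.Bochner.Basic
import Mathlib.MeasureTheory.Measure.Typeclasses.Probability
import Mathlib.MeasureTheory.Measure.Real
import Mathlib.Logic.Function.DependsOn
import Mathlib.Data.Finset.Sort
import Mathlib.Data.Finset.Max
import Mathlib.Algebra.BigOperators.Intervals
import Literature.ComputerArithmetic.ConnollyHighamMary2021.MartingaleProductBound
import Literature.ComputerArithmetic.ConnollyHighamMary2021.ProductLemmas
import Literature.ComputerArithmetic.ElararEtAl2023.VarianceBoundsProof
import Literature.ComputerArithmetic.HallmanIpsen2023.MartingaleBounds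
import HarnessLib

/-!
# Connolly–Higham–Mary 2021, §4.2–§4.3: the probabilistic backward error bounds (Theorems 4.8 over
# arbitrary index sets, 4.9, 4.10) and the mean of the error (Lemma 4.14, Theorem 4.15) PROVED

HONEST FRAMING: shared numerical engines serving client cells; rigour lives in the verifiers; every
published number belongs to a client cell's ledger, not to the engines group.

Source: M. P. Connolly, N. J. Higham, T. Mary, *Stochastic rounding and its probabilistic backward
error analysis*, SIAM J. Sci. Comput. 43(1) (2021) A566–A585, doi:10.1137/20M1334796
[cite: ConnollyHighamMary2021]; statements and proofs read verbatim from the authors' MIMS EPrint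
2020.12 (revised, = the SIAM text and numbering): eq. (4.2) `γ̃ₙ(λ)`, eq. (4.3) `Q(λ,n)`, Theorem 4.8
with its proof, eq. (4.8) `γ̃ₙ⁽ˢ⁾(λ)`, Theorems 4.9–4.11, Lemma 4.12, Theorem 4.13 with its proof,
Lemma 4.14 with its proof, Theorem 4.15 with its proof (pp. 9–14). Second source for Theorems 4.9/4.10:
M. Croci, M. Fasi, N. J. Higham, T. Mary, M. Mikaitis, *Stochastic rounding: implementation, error
analysis and applications*, R. Soc. Open Sci. 9 (2022) 211631, Theorems 6.2, 7.1, 7.2.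

Numbering. The companion fact file `ConnollyHighamMary2021.ProbabilisticBounds` names the product
bound "Thm. 4.6" (the number in the first EPrint version, as cited by Croci et al. [Thm 4.6]); in the
published numbering used here it is THEOREM 4.8, Lemma 4.12/Theorem 4.13 keep their numbers, and the
tree's `productBoundCHM_holds`, `productMeanOne_holds`, `recursiveSumUnbiased_holds`,
`ElararEtAl2023.innerProductUnbiased_holds` are Theorem 4.8 (consecutive indices), Lemma 4.12 and
Theorem 4.13.

Constants. The source's (4.2) is `γ̃ₙ(λ) = exp((λ√n·u + nu²)/(1−u)) − 1` (`gammaTildeP`), and (4.8)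
`γ̃ₙ⁽ˢ⁾(λ) = exp((2λ√n·u + 4nu²)/(1−2u)) − 1` is (4.2) with `u ← 2u` (`gammaTildeS`,
`gammaTildeS_eq`) — the substitution the source makes because the mode-2 SR errors satisfy `|δ| ≤ 2u`
(its (2.4)). The tree's `gammaTilde n u λ = exp(λ√n·u + nu²/(1−u)) − 1`, over which Theorem 4.8 was
PROVED (`productBoundCHM_holds`), is the SHARPER constant (`gammaTilde_le_gammaTildeP`), so every
bound below, stated with `gammaTilde`, implies the printed one (`*_printed` corollaries). In the error
model `SRErrorModel μ u δ` the letter `u` IS the bound on `|δₖ|`; instantiating `u ← 2u` gives the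
source's SR statements with `γ̃⁽ˢ⁾`.

**What is proved** (all over the tree's test-function error model `SRErrorModel μ u δ` =
Lemma 4.5's conclusion: `|δₖ| ≤ u`, `E[g(δ₀,…,δₖ₋₁)δₖ] = 0`).
* A sub-family `δ_{e(0)}, δ_{e(1)}, …` along a strictly increasing `e` is again an SR error model
  (`SRErrorModel.comp_strictMono`) — the remark that makes Theorem 4.8 applicable to the products
  `∏_{k∈K}(1+δₖ)` over the index SETS `K` met in backward error analysis ("some of the `δₖᵢ` will be
  zero, depending on the order", proof of Theorem 4.13).
* **THEOREM 4.8** for an arbitrary finite index set `K`, `ρₖ = ±1`: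
  `P(|∏_{k∈K}(1+δₖ)^{ρₖ} − 1| > γ̃_{|K|}(λ)) ≤ 2exp(−λ²/2)` (`measure_prod_zpow_sub_one_gt_le`), and the
  union bound over a finite family of such products with `|Kᵢ| ≤ N`
  (`measure_exists_prod_sub_one_gt_le`: failure probability `≤ 2|I|exp(−λ²/2) = 1 − Q(λ,|I|)`).
* **THEOREM 4.9** (inner products, any order): with `ŷ = Σᵢ aᵢbᵢ∏_{k∈Kᵢ}(1+δₖ)`, `|Kᵢ| ≤ n`
  (the standard model of an inner product evaluated in any order, [13, §3.1], as in the proof of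
  Theorem 4.13), `ŷ = (a+Δa)ᵀb = aᵀ(b+Δb)`, `|Δa| ≤ γ̃ₙ(λ)|a|`, `|Δb| ≤ γ̃ₙ(λ)|b|` with probability at
  least `Q(λ,n) = 1 − 2n·exp(−λ²/2)` (`innerProduct_backward`; for the tree's concrete recursive inner
  product `ElararEtAl2023.ipComputed`: `ipComputed_backward`).
* **THEOREM 4.10** (matrix–matrix products `C = AB`, `A ∈ ℝ^{m×n}`, `B ∈ ℝ^{n×p}`): column-wise
  `ĉⱼ = (A+ΔAⱼ)bⱼ`, `|ΔAⱼ| ≤ γ̃ₙ(λ)|A|` with probability at least `Q(λ,mn)` (`matMul_column_backward`;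
  the source prints "`j = 1:n`", read `j = 1:p`), and `|C − Ĉ| ≤ γ̃ₙ(λ)|A||B|` with probability at least
  `Q(λ,mnp)` (`matMul_forward`).
* **LEMMA 4.14** in test-function form: for a bounded measurable functional `F` of the errors with
  indices `< m` and a finite set `K` of indices `≥ m`, `E[F(δ)·∏_{k∈K}(1+δₖ)] = E[F(δ)]`
  (`integral_pastFn_mul_prod_eq`; with `F ≡ 1` this is Lemma 4.12 again).
* **THEOREM 4.15** (triangular solve by substitution under SR: `E(x̂) = x`), as the source proves it:
  if the computed unknowns satisfy `tᵢᵢx̂ᵢ = bᵢ∏_{Kᵢᵢ}(1+δ) − Σ_{j<i} tᵢⱼx̂ⱼ∏_{Kᵢⱼ}(1+δ)` where `x̂ⱼ`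
  depends only on errors that occur before those in `Kᵢⱼ`, then `E(x̂ᵢ) = xᵢ` for all `i`
  (`integral_subst_eq`), and the concrete instance: forward substitution in the natural order with one
  SR error per operation (`substSol`, `integral_substSol_eq`).

NOT typed here: THEOREM 4.11 (linear systems via LU factorization, probability
`Q(λ, n³/3 + 3n²/2 + 7n/6)`) — it rests on the backward error analysis of LU factorization
[13, Thm. 9.3], which the tree does not have.
-/

namespace Literature.ComputerArithmetic.ConnollyHighamMary2021

open _root_.MeasureTheory
open Finset
open scoped ENNReal
open Literature.ComputerArithmetic.ElararEtAl2023 (integral_pastFn_mul_eq_zero ipIndex ipComputed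
  ipComputed_eq_sum_prod card_ipIndex_le)
open Literature.ComputerArithmetic.HallmanIpsen2023 (u_nonneg)

/-! ### §0 The constants (4.2), (4.3), (4.8) -/

/-- `Q(λ,n) = 1 − n(1 − P(λ)) = 1 − 2n·exp(−λ²/2)`. [cite: ConnollyHighamMary2021, eq. (4.3)] -/
noncomputable def Q (lam : ℝ) (n : ℕ) : ℝ := 1 - 2 * n * Real.exp (-lam ^ 2 / 2)

/-- The printed constant `γ̃ₙ(λ) = exp((λ√n·u + nu²)/(1−u)) − 1 = λ√n·u + O(u²)` — [14, Thm. 2.4]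
after the change of variable `λ ← λ/(1−u)`. [cite: ConnollyHighamMary2021, eq. (4.2)] -/
noncomputable def gammaTildeP (n : ℕ) (u lam : ℝ) : ℝ :=
  Real.exp ((lam * Real.sqrt n * u + n * u ^ 2) / (1 - u)) - 1

/-- `γ̃ₙ⁽ˢ⁾(λ) = exp((2λ√n·u + 4nu²)/(1−2u)) − 1 = 2λ√n·u + O(u²)`, "which is `γ̃(λ)` in (4.2) with `u`
replaced by `2u`". [cite: ConnollyHighamMary2021, eq. (4.8)] -/
noncomputable def gammaTildeS (n : ℕ) (u lam : ℝ) : ℝ :=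
  Real.exp ((2 * lam * Real.sqrt n * u + 4 * n * u ^ 2) / (1 - 2 * u)) - 1

/-- `γ̃ₙ⁽ˢ⁾(λ)` is `γ̃ₙ(λ)` at `2u`. [cite: ConnollyHighamMary2021, eq. (4.8)] -/
theorem gammaTildeS_eq (n : ℕ) (u lam : ℝ) : gammaTildeS n u lam = gammaTildeP n (2 * u) lam := by
  unfold gammaTildeS gammaTildeP
  congr 2
  ring

/-- The tree's constant is sharper than the printed one: `γ̃ₙ(λ)_tree ≤ γ̃ₙ(λ)_(4.2)` for `0 ≤ u < 1`,
`λ ≥ 0` (`λ√n·u ≤ λ√n·u/(1−u)`). [cite: ConnollyHighamMary2021, eq. (4.2)] -/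
theorem gammaTilde_le_gammaTildeP {n : ℕ} {u lam : ℝ} (hu0 : 0 ≤ u) (hu1 : u < 1) (hlam : 0 ≤ lam) :
    gammaTilde n u lam ≤ gammaTildeP n u lam := by
  unfold gammaTilde gammaTildeP
  have h1 : 0 < 1 - u := by linarith
  have hA : 0 ≤ lam * Real.sqrt n * u := by positivity
  have key : lam * Real.sqrt n * u + n * u ^ 2 / (1 - u)
      ≤ (lam * Real.sqrt n * u + n * u ^ 2) / (1 - u) := by
    have hA' : lam * Real.sqrt n * u ≤ lam * Real.sqrt n * u / (1 - u) := by
      rw [le_div_iff₀ h1]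
      nlinarith
    rw [add_div]
    linarith
  linarith [Real.exp_le_exp.mpr key]

/-- `γ̃ₘ(λ) ≤ γ̃ₙ(λ)` for `m ≤ n` (`0 ≤ u ≤ 1`, `λ ≥ 0`) — used as "`γ̃_{n−i+2} ≤ γ̃ₙ`" in the inner
product analysis. [cite: ConnollyHighamMary2021, Thm. 4.9 proof (= [14, Thm. 3.1] proof)] -/
theorem gammaTilde_mono {m n : ℕ} (hmn : m ≤ n) {u lam : ℝ} (hu0 : 0 ≤ u) (hu1 : u ≤ 1)
    (hlam : 0 ≤ lam) : gammaTilde m u lam ≤ gammaTilde n u lam := by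
  unfold gammaTilde
  have hmn' : (m : ℝ) ≤ n := by exact_mod_cast hmn
  have hsq : Real.sqrt m ≤ Real.sqrt n := Real.sqrt_le_sqrt hmn'
  have hA : lam * Real.sqrt m * u ≤ lam * Real.sqrt n * u :=
    mul_le_mul_of_nonneg_right (mul_le_mul_of_nonneg_left hsq hlam) hu0
  have hB : (m : ℝ) * u ^ 2 / (1 - u) ≤ n * u ^ 2 / (1 - u) :=
    div_le_div_of_nonneg_right (mul_le_mul_of_nonneg_right hmn' (sq_nonneg u)) (by linarith)
  linarith [Real.exp_le_exp.mpr (add_le_add hA hB)]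

/-- `0 ≤ γ̃ₙ(λ)` for `0 ≤ u ≤ 1`, `λ ≥ 0`. [cite: ConnollyHighamMary2021, eq. (4.2)] -/
theorem gammaTilde_nonneg (n : ℕ) {u lam : ℝ} (hu0 : 0 ≤ u) (hu1 : u ≤ 1) (hlam : 0 ≤ lam) :
    0 ≤ gammaTilde n u lam := by
  have h0 : gammaTilde 0 u lam = 0 := by simp [gammaTilde]
  rw [← h0]
  exact gammaTilde_mono (Nat.zero_le n) hu0 hu1 hlam

/-- `1 − Q(λ,n) = 2n·exp(−λ²/2)`. [cite: ConnollyHighamMary2021, eq. (4.3)] -/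
theorem one_sub_Q (lam : ℝ) (n : ℕ) : 1 - Q lam n = 2 * n * Real.exp (-lam ^ 2 / 2) := by
  unfold Q; ring

section Model

variable {Ω : Type} [MeasurableSpace Ω] {μ : Measure Ω} {u : ℝ} {δ : ℕ → Ω → ℝ}

/-! ### §1 Sub-families of a mean-independent sequence -/

/-- **A sub-family of SR errors is an SR error model.** If `δ₀, δ₁, …` are bounded by `u` and mean
independent with mean zero, so are `δ_{e(0)}, δ_{e(1)}, …` for every strictly increasing `e` (a bounded
measurable function of `δ_{e(0)}, …, δ_{e(k−1)}` is one of `δ₀, …, δ_{e(k)−1}`). This is why Theorem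
4.8, stated for `δ₁, …, δₙ`, applies to the rounding errors "drawn from" a computation in the proofs
of Theorems 4.9–4.11, 4.13, 4.15. [cite: ConnollyHighamMary2021, Lemma 4.5 / Thm. 4.9 proof] -/
theorem SRErrorModel.comp_strictMono (h : SRErrorModel μ u δ) {e : ℕ → ℕ} (he : StrictMono e) :
    SRErrorModel μ u (fun k => δ (e k)) where
  measurable k := h.measurable (e k)
  bounded k ω := h.bounded (e k) ω
  meanIndep k g hg hgb := by
    have key := h.meanIndep (e k) (fun w => g (fun i : Fin k => w ⟨e i, he i.isLt⟩)) ?_ ?_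
    · simpa using key
    · exact hg.comp (measurable_pi_lambda _ (fun i => measurable_pi_apply _))
    · obtain ⟨C, hC⟩ := hgb
      exact ⟨C, fun w => hC _⟩

/-! ### §2 Theorem 4.8 over an arbitrary finite index set -/

/-- Increasing enumeration of a finite set of indices, continued strictly increasingly beyond it.
[folklore] -/
private noncomputable def enumExt (K : Finset ℕ) (i : ℕ) : ℕ :=
  if hi : i < K.card then K.orderEmbOfFin rfl ⟨i, hi⟩ else K.sup id + 1 + i

/-- [folklore] the enumeration lands in `K` below `|K|`. -/
private theorem enumExt_mem {K : Finset ℕ} {i : ℕ} (hi : i < K.card) : enumExt K i ∈ K := by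
  unfold enumExt
  rw [dif_pos hi]
  exact Finset.orderEmbOfFin_mem K rfl _

/-- [folklore] the continued enumeration is strictly increasing. -/
private theorem enumExt_strictMono (K : Finset ℕ) : StrictMono (enumExt K) := by
  refine strictMono_nat_of_lt_succ (fun i => ?_)
  by_cases hi1 : i + 1 < K.card
  · have hi : i < K.card := by omega
    unfold enumExt
    rw [dif_pos hi, dif_pos hi1]
    exact (K.orderEmbOfFin rfl).strictMono (by simp)
  · by_cases hi : i < K.card
    · have hmem := enumExt_mem hi
      have hle : enumExt K i ≤ K.sup id := Finset.le_sup (f := id) hmem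
      unfold enumExt at hle ⊢
      rw [dif_pos hi] at hle ⊢
      rw [dif_neg hi1]
      omega
    · unfold enumExt
      rw [dif_neg hi, dif_neg hi1]
      omega

/-- [folklore] the enumeration maps `{0, …, |K|−1}` onto `K`. -/
private theorem image_enumExt_range (K : Finset ℕ) : (range K.card).image (enumExt K) = K := by
  ext k
  constructor
  · intro hk
    obtain ⟨i, hi, rfl⟩ := Finset.mem_image.mp hk
    exact enumExt_mem (Finset.mem_range.mp hi)
  · intro hk
    have : k ∈ Set.range (K.orderEmbOfFin rfl) := by
      rw [Finset.range_orderEmbOfFin]; exact hk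
    obtain ⟨i, hi⟩ := this
    refine Finset.mem_image.mpr ⟨i, Finset.mem_range.mpr i.isLt, ?_⟩
    unfold enumExt
    rw [dif_pos i.isLt]
    exact hi

/-- **THEOREM 4.8 for an arbitrary finite set of error indices.** Under the SR error model with
`0 < u < 1`, for every finite `K ⊆ ℕ`, exponents `ρₖ = ±1` and `λ > 0`:
`|∏_{k∈K}(1+δₖ)^{ρₖ} − 1| ≤ γ̃_{|K|}(λ)` fails with probability at most `2exp(−λ²/2)` — Theorem 4.8
applied to the martingale difference sequence `δ_{k₁}, δ_{k₂}, …` (`k₁ < k₂ < …` the elements of `K`).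
[cite: ConnollyHighamMary2021, Thm. 4.8] -/
theorem measure_prod_zpow_sub_one_gt_le [IsProbabilityMeasure μ] (h : SRErrorModel μ u δ)
    (hu : 0 < u) (hu1 : u < 1) (K : Finset ℕ) {ρ : ℕ → ℤ} (hρ : ∀ k, ρ k = 1 ∨ ρ k = -1)
    {lam : ℝ} (hlam : 0 < lam) :
    μ {ω | gammaTilde K.card u lam < |(∏ k ∈ K, (1 + δ k ω) ^ (ρ k)) - 1|}
      ≤ ENNReal.ofReal (2 * Real.exp (-lam ^ 2 / 2)) := by
  classical
  have he := enumExt_strictMono K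
  have key := productBoundCHM_holds Ω μ u (fun k => δ (enumExt K k)) hu hu1 (h.comp_strictMono he)
    K.card (fun i => ρ (enumExt K i)) (fun i => hρ _) lam hlam
  have hprod : ∀ ω, ∏ k ∈ K, (1 + δ k ω) ^ (ρ k)
      = ∏ i ∈ range K.card, (1 + δ (enumExt K i) ω) ^ (ρ (enumExt K i)) := by
    intro ω
    rw [← image_enumExt_range K, Finset.prod_image (fun i _ j _ hij => he.injective hij),
      image_enumExt_range K]
  simp_rw [hprod]
  exact key

/-- **THEOREM 4.8, the case `ρ ≡ 1`:** `P(|∏_{k∈K}(1+δₖ) − 1| > γ̃_{|K|}(λ)) ≤ 2exp(−λ²/2)`.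
[cite: ConnollyHighamMary2021, Thm. 4.8] -/
theorem measure_prod_sub_one_gt_le [IsProbabilityMeasure μ] (h : SRErrorModel μ u δ)
    (hu : 0 < u) (hu1 : u < 1) (K : Finset ℕ) {lam : ℝ} (hlam : 0 < lam) :
    μ {ω | gammaTilde K.card u lam < |(∏ k ∈ K, (1 + δ k ω)) - 1|}
      ≤ ENNReal.ofReal (2 * Real.exp (-lam ^ 2 / 2)) := by
  have key := measure_prod_zpow_sub_one_gt_le h hu hu1 K (ρ := fun _ => 1) (fun _ => Or.inl rfl) hlam
  simpa only [zpow_one] using key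

/-! ### §3 The union bound behind `Q(λ,n) = 1 − n(1 − P(λ))` -/

/-- **The union bound of the proofs of Theorems 4.9–4.11:** for a finite family of error products
`∏_{k∈Kᵢ}(1+δₖ)^{ρₖ}`, `i ∈ I`, with `|Kᵢ| ≤ N`, the probability that SOME `|∏ − 1|` exceeds `γ̃_N(λ)` is
at most `2|I|exp(−λ²/2) = 1 − Q(λ,|I|)`. [cite: ConnollyHighamMary2021, eq. (4.3) / Thm. 4.9 proof] -/
theorem measure_exists_prod_zpow_sub_one_gt_le [IsProbabilityMeasure μ] (h : SRErrorModel μ u δ)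
    (hu : 0 < u) (hu1 : u < 1) {ι : Type*} (I : Finset ι) (K : ι → Finset ℕ) {N : ℕ}
    (hK : ∀ i ∈ I, (K i).card ≤ N) {ρ : ℕ → ℤ} (hρ : ∀ k, ρ k = 1 ∨ ρ k = -1)
    {lam : ℝ} (hlam : 0 < lam) :
    μ {ω | ∃ i ∈ I, gammaTilde N u lam < |(∏ k ∈ K i, (1 + δ k ω) ^ (ρ k)) - 1|}
      ≤ ENNReal.ofReal (2 * I.card * Real.exp (-lam ^ 2 / 2)) := by
  have hset : {ω | ∃ i ∈ I, gammaTilde N u lam < |(∏ k ∈ K i, (1 + δ k ω) ^ (ρ k)) - 1|}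
      = ⋃ i ∈ I, {ω | gammaTilde N u lam < |(∏ k ∈ K i, (1 + δ k ω) ^ (ρ k)) - 1|} := by
    ext ω; simp
  rw [hset]
  refine (measure_biUnion_finset_le I _).trans ?_
  have hstep : ∀ i ∈ I, μ {ω | gammaTilde N u lam < |(∏ k ∈ K i, (1 + δ k ω) ^ (ρ k)) - 1|}
      ≤ ENNReal.ofReal (2 * Real.exp (-lam ^ 2 / 2)) := by
    intro i hi
    refine (measure_mono (fun ω hω => ?_)).trans (measure_prod_zpow_sub_one_gt_le h hu hu1 (K i) hρ hlam)
    exact (gammaTilde_mono (hK i hi) hu.le hu1.le hlam.le).trans_lt hω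
  calc ∑ i ∈ I, μ {ω | gammaTilde N u lam < |(∏ k ∈ K i, (1 + δ k ω) ^ (ρ k)) - 1|}
      ≤ ∑ _i ∈ I, ENNReal.ofReal (2 * Real.exp (-lam ^ 2 / 2)) := Finset.sum_le_sum hstep
    _ = ENNReal.ofReal (2 * I.card * Real.exp (-lam ^ 2 / 2)) := by
      rw [Finset.sum_const, nsmul_eq_mul, ← ENNReal.ofReal_natCast,
        ← ENNReal.ofReal_mul (Nat.cast_nonneg _)]
      congr 1; ring

/-- **The union bound, case `ρ ≡ 1`.** [cite: ConnollyHighamMary2021, eq. (4.3) / Thm. 4.9 proof] -/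
theorem measure_exists_prod_sub_one_gt_le [IsProbabilityMeasure μ] (h : SRErrorModel μ u δ)
    (hu : 0 < u) (hu1 : u < 1) {ι : Type*} (I : Finset ι) (K : ι → Finset ℕ) {N : ℕ}
    (hK : ∀ i ∈ I, (K i).card ≤ N) {lam : ℝ} (hlam : 0 < lam) :
    μ {ω | ∃ i ∈ I, gammaTilde N u lam < |(∏ k ∈ K i, (1 + δ k ω)) - 1|}
      ≤ ENNReal.ofReal (2 * I.card * Real.exp (-lam ^ 2 / 2)) := by
  have key := measure_exists_prod_zpow_sub_one_gt_le h hu hu1 I K hK (ρ := fun _ => 1)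
    (fun _ => Or.inl rfl) hlam
  simpa only [zpow_one] using key

/-- [folklore] "with probability at least `1 − p`": if the failure event has measure `≤ p` then the
success event has real measure `≥ 1 − p` (no measurability needed). -/
private theorem one_sub_le_measureReal [IsProbabilityMeasure μ] {P : Ω → Prop} {p : ℝ} (hp : 0 ≤ p)
    (h : μ {ω | ¬ P ω} ≤ ENNReal.ofReal p) : 1 - p ≤ μ.real {ω | P ω} := by
  set s : Set Ω := {ω | P ω} with hs
  have hc : {ω | ¬ P ω} = sᶜ := rfl
  rw [hc] at h
  have h1 : (1 : ℝ≥0∞) ≤ μ s + ENNReal.ofReal p :=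
    calc (1 : ℝ≥0∞) = μ Set.univ := measure_univ.symm
      _ = μ (s ∪ sᶜ) := by rw [Set.union_compl_self]
      _ ≤ μ s + μ sᶜ := measure_union_le _ _
      _ ≤ μ s + ENNReal.ofReal p := add_le_add le_rfl h
  have hne : μ s + ENNReal.ofReal p ≠ ∞ :=
    ENNReal.add_ne_top.mpr ⟨measure_ne_top _ _, ENNReal.ofReal_ne_top⟩
  have h2 := ENNReal.toReal_mono hne h1
  rw [ENNReal.toReal_one, ENNReal.toReal_add (measure_ne_top _ _) ENNReal.ofReal_ne_top,
    ENNReal.toReal_ofReal hp] at h2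
  rw [measureReal_def]
  linarith

/-- **The mechanism of Theorems 4.9–4.11.** If a property of the outcome holds whenever EVERY error
product of a finite family (`|Kᵢ| ≤ N`, `i ∈ I`) satisfies `|∏_{k∈Kᵢ}(1+δₖ) − 1| ≤ g` for some
`g ≥ γ̃_N(λ)`, then it holds with probability at least `1 − 2|I|exp(−λ²/2)` (`= Q(λ,|I|)`).
[cite: ConnollyHighamMary2021, eq. (4.3) / Thm. 4.9 proof (= [14, Thm. 3.1] proof)] -/
theorem measureReal_of_products_ge [IsProbabilityMeasure μ] (h : SRErrorModel μ u δ) (hu : 0 < u)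
    (hu1 : u < 1) {ι : Type*} (I : Finset ι) (K : ι → Finset ℕ) {N : ℕ}
    (hK : ∀ i ∈ I, (K i).card ≤ N) {lam : ℝ} (hlam : 0 < lam) {g : ℝ} (hg : gammaTilde N u lam ≤ g)
    {P : Ω → Prop} (hP : ∀ ω, (∀ i ∈ I, |(∏ k ∈ K i, (1 + δ k ω)) - 1| ≤ g) → P ω) :
    1 - 2 * I.card * Real.exp (-lam ^ 2 / 2) ≤ μ.real {ω | P ω} := by
  refine one_sub_le_measureReal (by positivity) ((measure_mono (fun ω hω => ?_)).trans
    (measure_exists_prod_sub_one_gt_le h hu hu1 I K hK hlam))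
  simp only [Set.mem_setOf_eq] at hω ⊢
  by_contra hcon
  push Not at hcon
  exact hω (hP ω (fun i hi => (hcon i hi).trans hg))

/-! ### §4 Theorem 4.9 — inner products, any order of evaluation -/

/-- The backward-error bookkeeping of [14, Thm. 3.1]: if `|ψᵢ − 1| ≤ g` then `Σ aᵢbᵢψᵢ =
Σ (aᵢ+Δaᵢ)bᵢ = Σ aᵢ(bᵢ+Δbᵢ)` with `|Δaᵢ| ≤ g|aᵢ|`, `|Δbᵢ| ≤ g|bᵢ|` (`Δaᵢ = aᵢ(ψᵢ−1)`,
`Δbᵢ = bᵢ(ψᵢ−1)`). [cite: ConnollyHighamMary2021, Thm. 4.9 proof (= [14, Thm. 3.1] proof)] -/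
theorem backward_of_products {ι : Type*} (I : Finset ι) (a b ψ : ι → ℝ) {g : ℝ}
    (hψ : ∀ i ∈ I, |ψ i - 1| ≤ g) :
    ∃ Δa Δb : ι → ℝ, (∀ i ∈ I, |Δa i| ≤ g * |a i| ∧ |Δb i| ≤ g * |b i|) ∧
      ∑ i ∈ I, a i * b i * ψ i = ∑ i ∈ I, (a i + Δa i) * b i ∧
      ∑ i ∈ I, a i * b i * ψ i = ∑ i ∈ I, a i * (b i + Δb i) := by
  refine ⟨fun i => a i * (ψ i - 1), fun i => b i * (ψ i - 1), fun i hi => ⟨?_, ?_⟩,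
    Finset.sum_congr rfl (fun i _ => by ring), Finset.sum_congr rfl (fun i _ => by ring)⟩
  · rw [abs_mul, mul_comm g]
    exact mul_le_mul_of_nonneg_left (hψ i hi) (abs_nonneg _)
  · rw [abs_mul, mul_comm g]
    exact mul_le_mul_of_nonneg_left (hψ i hi) (abs_nonneg _)

/-- The forward-error bookkeeping of [14, Thm. 3.1]: if `|ψᵢ − 1| ≤ g` then
`|Σ aᵢbᵢ − Σ aᵢbᵢψᵢ| ≤ g Σ|aᵢ||bᵢ|`. [cite: ConnollyHighamMary2021, Thm. 4.10 (4.11) (= [14, Thm. 3.1])] -/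
theorem forward_of_products {ι : Type*} (I : Finset ι) (a b ψ : ι → ℝ) {g : ℝ}
    (hψ : ∀ i ∈ I, |ψ i - 1| ≤ g) :
    |(∑ i ∈ I, a i * b i) - ∑ i ∈ I, a i * b i * ψ i| ≤ g * ∑ i ∈ I, |a i| * |b i| := by
  rw [← Finset.sum_sub_distrib, Finset.mul_sum]
  refine (Finset.abs_sum_le_sum_abs _ _).trans (Finset.sum_le_sum (fun i hi => ?_))
  rw [show a i * b i - a i * b i * ψ i = -(a i * b i * (ψ i - 1)) by ring, abs_neg, abs_mul, abs_mul]
  calc |a i| * |b i| * |ψ i - 1| ≤ |a i| * |b i| * g :=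
        mul_le_mul_of_nonneg_left (hψ i hi) (by positivity)
    _ = g * (|a i| * |b i|) := by ring

/-- **THEOREM 4.9 (inner products), general index set.** Let `ŷ = Σ_{i∈I} aᵢbᵢ∏_{k∈Kᵢ}(1+δₖ)` with
`|Kᵢ| ≤ n` — the computed inner product in ANY order of evaluation ([13, §3.1]: every term meets at
most `n` rounding errors). Under the SR error model (`0 < u < 1`), for every `λ > 0`, with probability
at least `1 − 2|I|exp(−λ²/2)`: `ŷ = (a+Δa)ᵀb = aᵀ(b+Δb)` with `|Δa| ≤ γ̃ₙ(λ)|a|`, `|Δb| ≤ γ̃ₙ(λ)|b|`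
componentwise. [cite: ConnollyHighamMary2021, Thm. 4.9] -/
theorem innerProduct_backward [IsProbabilityMeasure μ] (h : SRErrorModel μ u δ) (hu : 0 < u)
    (hu1 : u < 1) {ι : Type*} (I : Finset ι) (a b : ι → ℝ) (K : ι → Finset ℕ) {n : ℕ}
    (hK : ∀ i ∈ I, (K i).card ≤ n) {lam : ℝ} (hlam : 0 < lam) :
    1 - 2 * I.card * Real.exp (-lam ^ 2 / 2) ≤ μ.real {ω | ∃ Δa Δb : ι → ℝ,
      (∀ i ∈ I, |Δa i| ≤ gammaTilde n u lam * |a i| ∧ |Δb i| ≤ gammaTilde n u lam * |b i|) ∧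
      ∑ i ∈ I, a i * b i * ∏ k ∈ K i, (1 + δ k ω) = ∑ i ∈ I, (a i + Δa i) * b i ∧
      ∑ i ∈ I, a i * b i * ∏ k ∈ K i, (1 + δ k ω) = ∑ i ∈ I, a i * (b i + Δb i)} :=
  measureReal_of_products_ge h hu hu1 I K hK hlam le_rfl
    (fun ω hω => backward_of_products I a b (fun i => ∏ k ∈ K i, (1 + δ k ω)) hω)

/-- **THEOREM 4.9 with the printed constant (4.2)** `γ̃ₙ(λ) = exp((λ√n·u + nu²)/(1−u)) − 1`.
[cite: ConnollyHighamMary2021, Thm. 4.9 / eq. (4.2)] -/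
theorem innerProduct_backward_printed [IsProbabilityMeasure μ] (h : SRErrorModel μ u δ) (hu : 0 < u)
    (hu1 : u < 1) {ι : Type*} (I : Finset ι) (a b : ι → ℝ) (K : ι → Finset ℕ) {n : ℕ}
    (hK : ∀ i ∈ I, (K i).card ≤ n) {lam : ℝ} (hlam : 0 < lam) :
    1 - 2 * I.card * Real.exp (-lam ^ 2 / 2) ≤ μ.real {ω | ∃ Δa Δb : ι → ℝ,
      (∀ i ∈ I, |Δa i| ≤ gammaTildeP n u lam * |a i| ∧ |Δb i| ≤ gammaTildeP n u lam * |b i|) ∧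
      ∑ i ∈ I, a i * b i * ∏ k ∈ K i, (1 + δ k ω) = ∑ i ∈ I, (a i + Δa i) * b i ∧
      ∑ i ∈ I, a i * b i * ∏ k ∈ K i, (1 + δ k ω) = ∑ i ∈ I, a i * (b i + Δb i)} :=
  measureReal_of_products_ge h hu hu1 I K hK hlam (gammaTilde_le_gammaTildeP hu.le hu1 hlam.le)
    (fun ω hω => backward_of_products I a b (fun i => ∏ k ∈ K i, (1 + δ k ω)) hω)

/-- **THEOREM 4.9 verbatim, for stochastic rounding:** the SR errors satisfy `|δ| ≤ 2u` (the source's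
(2.4)), i.e. the model `SRErrorModel μ (2u) δ`; then (for `0 < u`, `2u < 1`) `ŷ = (a+Δa)ᵀb = aᵀ(b+Δb)`,
`|Δa| ≤ γ̃ₙ⁽ˢ⁾(λ)|a|`, `|Δb| ≤ γ̃ₙ⁽ˢ⁾(λ)|b|` with probability at least `1 − 2|I|exp(−λ²/2)`.
[cite: ConnollyHighamMary2021, Thm. 4.9 / eq. (4.8)] -/
theorem innerProduct_backward_SR [IsProbabilityMeasure μ] (h : SRErrorModel μ (2 * u) δ)
    (hu : 0 < u) (hu1 : 2 * u < 1) {ι : Type*} (I : Finset ι) (a b : ι → ℝ) (K : ι → Finset ℕ)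
    {n : ℕ} (hK : ∀ i ∈ I, (K i).card ≤ n) {lam : ℝ} (hlam : 0 < lam) :
    1 - 2 * I.card * Real.exp (-lam ^ 2 / 2) ≤ μ.real {ω | ∃ Δa Δb : ι → ℝ,
      (∀ i ∈ I, |Δa i| ≤ gammaTildeS n u lam * |a i| ∧ |Δb i| ≤ gammaTildeS n u lam * |b i|) ∧
      ∑ i ∈ I, a i * b i * ∏ k ∈ K i, (1 + δ k ω) = ∑ i ∈ I, (a i + Δa i) * b i ∧
      ∑ i ∈ I, a i * b i * ∏ k ∈ K i, (1 + δ k ω) = ∑ i ∈ I, a i * (b i + Δb i)} := by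
  have key := innerProduct_backward_printed h (by linarith) hu1 I a b K hK hlam
  simpa only [gammaTildeS_eq] using key

/-- **THEOREM 4.9 for the recursive inner product `ŷ = ((a₁b₁ + a₂b₂) + a₃b₃) + ⋯` of the tree**
(`ElararEtAl2023.ipComputed`: one SR error per multiplication and per addition, `n` terms indexed
`1, …, n`, each meeting at most `n` errors): `ŷ = (a+Δa)ᵀb = aᵀ(b+Δb)`, `|Δa| ≤ γ̃ₙ(λ)|a|`,
`|Δb| ≤ γ̃ₙ(λ)|b|` with probability at least `Q(λ,n)`. [cite: ConnollyHighamMary2021, Thm. 4.9] -/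
theorem ipComputed_backward [IsProbabilityMeasure μ] (h : SRErrorModel μ u δ) (hu : 0 < u)
    (hu1 : u < 1) (n : ℕ) (a b : ℕ → ℝ) {lam : ℝ} (hlam : 0 < lam) :
    Q lam n ≤ μ.real {ω | ∃ Δa Δb : ℕ → ℝ,
      (∀ i ∈ Icc 1 n, |Δa i| ≤ gammaTilde n u lam * |a i| ∧ |Δb i| ≤ gammaTilde n u lam * |b i|) ∧
      ipComputed n a b (fun k => δ k ω) = ∑ i ∈ Icc 1 n, (a i + Δa i) * b i ∧
      ipComputed n a b (fun k => δ k ω) = ∑ i ∈ Icc 1 n, a i * (b i + Δb i)} := by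
  have key := innerProduct_backward h hu hu1 (Icc 1 n) a b (ipIndex n)
    (fun i hi => card_ipIndex_le hi) hlam
  simp only [Nat.card_Icc, Nat.add_sub_cancel, ← ipComputed_eq_sum_prod] at key
  unfold Q
  exact key

/-- **The forward bound implied by Theorem 4.9:** `|y − ŷ| ≤ γ̃ₙ(λ)|a|ᵀ|b|` with probability at least
`1 − 2|I|exp(−λ²/2)`. [cite: ConnollyHighamMary2021, Thm. 4.9 (cf. [14, Thm. 3.1])] -/
theorem innerProduct_forward [IsProbabilityMeasure μ] (h : SRErrorModel μ u δ) (hu : 0 < u)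
    (hu1 : u < 1) {ι : Type*} (I : Finset ι) (a b : ι → ℝ) (K : ι → Finset ℕ) {n : ℕ}
    (hK : ∀ i ∈ I, (K i).card ≤ n) {lam : ℝ} (hlam : 0 < lam) :
    1 - 2 * I.card * Real.exp (-lam ^ 2 / 2) ≤ μ.real {ω |
      |(∑ i ∈ I, a i * b i) - ∑ i ∈ I, a i * b i * ∏ k ∈ K i, (1 + δ k ω)|
        ≤ gammaTilde n u lam * ∑ i ∈ I, |a i| * |b i|} :=
  measureReal_of_products_ge h hu hu1 I K hK hlam le_rfl
    (fun ω hω => forward_of_products I a b (fun i => ∏ k ∈ K i, (1 + δ k ω)) hω)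

/-! ### §5 Theorem 4.10 — matrix–matrix products -/

/-- **THEOREM 4.10 (matrix–matrix products), eq. (4.10).** Let `C = AB`, `A ∈ ℝ^{m×n}`,
`B ∈ ℝ^{n×p}` (entries `A i k`, `B k j`, `i < m`, `k < n`, `j < p`), computed as `mp` inner products
in any order: `ĉᵢⱼ = Σₖ aᵢₖbₖⱼ∏_{t∈Kᵢⱼₖ}(1+δₜ)`, `|Kᵢⱼₖ| ≤ n`. Under the SR error model, for each
column `j`, with probability at least `Q(λ,mn)`: `ĉⱼ = (A + ΔAⱼ)bⱼ` with `|ΔAⱼ| ≤ γ̃ₙ(λ)|A|` (the source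
prints the column range as "`j = 1:n`"; `B` has `p` columns). [cite: ConnollyHighamMary2021, Thm. 4.10] -/
theorem matMul_column_backward [IsProbabilityMeasure μ] (h : SRErrorModel μ u δ) (hu : 0 < u)
    (hu1 : u < 1) (m n p : ℕ) (A B : ℕ → ℕ → ℝ) (K : ℕ → ℕ → ℕ → Finset ℕ)
    (hK : ∀ i ∈ range m, ∀ j ∈ range p, ∀ k ∈ range n, (K i j k).card ≤ n) {j : ℕ}
    (hj : j ∈ range p) {lam : ℝ} (hlam : 0 < lam) :
    Q lam (m * n) ≤ μ.real {ω | ∃ ΔA : ℕ → ℕ → ℝ,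
      (∀ i ∈ range m, ∀ k ∈ range n, |ΔA i k| ≤ gammaTilde n u lam * |A i k|) ∧
      ∀ i ∈ range m, ∑ k ∈ range n, A i k * B k j * ∏ t ∈ K i j k, (1 + δ t ω)
        = ∑ k ∈ range n, (A i k + ΔA i k) * B k j} := by
  have key := measureReal_of_products_ge h hu hu1 (range m ×ˢ range n)
    (fun ik : ℕ × ℕ => K ik.1 j ik.2) (N := n)
    (fun ik hik => hK ik.1 (Finset.mem_product.mp hik).1 j hj ik.2 (Finset.mem_product.mp hik).2)
    hlam le_rfl (P := fun ω => ∃ ΔA : ℕ → ℕ → ℝ,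
      (∀ i ∈ range m, ∀ k ∈ range n, |ΔA i k| ≤ gammaTilde n u lam * |A i k|) ∧
      ∀ i ∈ range m, ∑ k ∈ range n, A i k * B k j * ∏ t ∈ K i j k, (1 + δ t ω)
        = ∑ k ∈ range n, (A i k + ΔA i k) * B k j) (fun ω hω => ?_)
  · rw [Finset.card_product, Finset.card_range, Finset.card_range] at key
    unfold Q
    exact_mod_cast key
  · refine ⟨fun i k => A i k * ((∏ t ∈ K i j k, (1 + δ t ω)) - 1), fun i hi k hk => ?_,
      fun i _ => Finset.sum_congr rfl (fun k _ => by ring)⟩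
    rw [abs_mul, mul_comm (gammaTilde n u lam)]
    exact mul_le_mul_of_nonneg_left (hω (i, k) (Finset.mem_product.mpr ⟨hi, hk⟩)) (abs_nonneg _)

/-- **THEOREM 4.10, eq. (4.11):** `|C − Ĉ| ≤ γ̃ₙ(λ)|A||B|` entrywise, with probability at least
`Q(λ,mnp)`. [cite: ConnollyHighamMary2021, Thm. 4.10] -/
theorem matMul_forward [IsProbabilityMeasure μ] (h : SRErrorModel μ u δ) (hu : 0 < u)
    (hu1 : u < 1) (m n p : ℕ) (A B : ℕ → ℕ → ℝ) (K : ℕ → ℕ → ℕ → Finset ℕ)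
    (hK : ∀ i ∈ range m, ∀ j ∈ range p, ∀ k ∈ range n, (K i j k).card ≤ n) {lam : ℝ}
    (hlam : 0 < lam) :
    Q lam (m * n * p) ≤ μ.real {ω | ∀ i ∈ range m, ∀ j ∈ range p,
      |(∑ k ∈ range n, A i k * B k j) - ∑ k ∈ range n, A i k * B k j * ∏ t ∈ K i j k, (1 + δ t ω)|
        ≤ gammaTilde n u lam * ∑ k ∈ range n, |A i k| * |B k j|} := by
  have key := measureReal_of_products_ge h hu hu1 ((range m ×ˢ range p) ×ˢ range n)
    (fun x : (ℕ × ℕ) × ℕ => K x.1.1 x.1.2 x.2) (N := n)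
    (fun x hx => hK x.1.1 (Finset.mem_product.mp (Finset.mem_product.mp hx).1).1 x.1.2
      (Finset.mem_product.mp (Finset.mem_product.mp hx).1).2 x.2 (Finset.mem_product.mp hx).2)
    hlam le_rfl (P := fun ω => ∀ i ∈ range m, ∀ j ∈ range p,
      |(∑ k ∈ range n, A i k * B k j) - ∑ k ∈ range n, A i k * B k j * ∏ t ∈ K i j k, (1 + δ t ω)|
        ≤ gammaTilde n u lam * ∑ k ∈ range n, |A i k| * |B k j|) (fun ω hω i hi j hj => ?_)
  · rw [Finset.card_product, Finset.card_product, Finset.card_range, Finset.card_range,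
      Finset.card_range] at key
    unfold Q
    have hc : ((m * p * n : ℕ) : ℝ) = ((m * n * p : ℕ) : ℝ) := by push_cast; ring
    rw [hc] at key
    exact_mod_cast key
  · exact forward_of_products (range n) (fun k => A i k) (fun k => B k j)
      (fun k => ∏ t ∈ K i j k, (1 + δ t ω))
      (fun k hk => hω ((i, j), k) (Finset.mem_product.mpr ⟨Finset.mem_product.mpr ⟨hi, hj⟩, hk⟩))

/-! ### §6 Lemma 4.14 — conditional mean of an error product given earlier errors -/

/-- [folklore] a measurable function with a sure bound is integrable on a finite measure space. -/
private theorem integrable_of_abs_le [IsFiniteMeasure μ] {f : Ω → ℝ} (hf : Measurable f) {C : ℝ}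
    (hC : ∀ ω, |f ω| ≤ C) : Integrable f μ :=
  Integrable.of_mem_Icc (-C) C hf.aemeasurable (ae_of_all _ fun ω => abs_le.mp (hC ω))

/-- [folklore] `|∏_{k∈s}(1 + v k)| ≤ (1+u)^{|s|}` on the cube `|v k| ≤ u`. -/
private theorem abs_prod_one_add_le {u : ℝ} (s : Finset ℕ) {v : ℕ → ℝ} (hv : ∀ j, |v j| ≤ u) :
    |∏ k ∈ s, (1 + v k)| ≤ (1 + u) ^ s.card := by
  rw [Finset.abs_prod]
  calc ∏ k ∈ s, |1 + v k| ≤ ∏ _k ∈ s, (1 + u) :=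
        Finset.prod_le_prod (fun _ _ => abs_nonneg _) (fun k _ =>
          (abs_add_le 1 (v k)).trans (by rw [abs_one]; linarith [hv k]))
    _ = (1 + u) ^ s.card := Finset.prod_const _

/-- **LEMMA 4.14 (test-function form).** Let `F` be a bounded measurable functional of the errors
`δ₀, …, δ_{m−1}` ("`δ₋ₘ, …, δ₀`" in the source) and `K` a finite set of LATER indices (`k ≥ m`). Under
the SR error model, `E[F(δ)·∏_{k∈K}(1+δₖ)] = E[F(δ)]` — i.e. `E(∏_{k∈K}(1+δₖ) | δ₀,…,δ_{m−1}) = 1`. Proof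
as in the source, by induction on `max K` with the tower property in the form
`E[G(δ_{<k})δₖ] = 0`. [cite: ConnollyHighamMary2021, Lemma 4.14] -/
theorem integral_pastFn_mul_prod_eq [IsFiniteMeasure μ] (h : SRErrorModel μ u δ) (hu : 0 ≤ u)
    {m : ℕ} {F : (ℕ → ℝ) → ℝ} (hF : Measurable F) (hdep : DependsOn F (Set.Iio m))
    (hbd : ∃ C, ∀ v : ℕ → ℝ, (∀ j, |v j| ≤ u) → |F v| ≤ C) (K : Finset ℕ)
    (hK : ∀ k ∈ K, m ≤ k) :
    ∫ ω, F (fun i => δ i ω) * ∏ k ∈ K, (1 + δ k ω) ∂μ = ∫ ω, F (fun i => δ i ω) ∂μ := by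
  obtain ⟨C, hC⟩ := hbd
  have hFm : Measurable (fun ω => F (fun i => δ i ω)) :=
    hF.comp (measurable_pi_lambda _ (fun i => h.measurable i))
  induction K using Finset.induction_on_max with
  | empty => simp
  | insert a s hlt ih =>
    have ha : a ∉ s := fun has => lt_irrefl _ (hlt a has)
    have hma : m ≤ a := hK a (Finset.mem_insert_self a s)
    have hKs : ∀ k ∈ s, m ≤ k := fun k hk => hK k (Finset.mem_insert_of_mem hk)
    have hsplit : ∀ ω, F (fun i => δ i ω) * ∏ k ∈ insert a s, (1 + δ k ω)
        = F (fun i => δ i ω) * ∏ k ∈ s, (1 + δ k ω)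
          + (F (fun i => δ i ω) * ∏ k ∈ s, (1 + δ k ω)) * δ a ω := by
      intro ω; rw [Finset.prod_insert ha]; ring
    simp_rw [hsplit]
    have hGm : Measurable (fun ω => F (fun i => δ i ω) * ∏ k ∈ s, (1 + δ k ω)) :=
      hFm.mul (Finset.measurable_prod s (fun k _ => (h.measurable k).const_add 1))
    have hGi : Integrable (fun ω => F (fun i => δ i ω) * ∏ k ∈ s, (1 + δ k ω)) μ := by
      refine integrable_of_abs_le hGm (C := C * (1 + u) ^ s.card) (fun ω => ?_)
      rw [abs_mul]
      exact mul_le_mul (hC _ (fun j => h.bounded j ω)) (abs_prod_one_add_le s (fun j => h.bounded j ω))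
        (abs_nonneg _) ((abs_nonneg _).trans (hC _ (fun j => h.bounded j ω)))
    have hGδ : Integrable (fun ω => (F (fun i => δ i ω) * ∏ k ∈ s, (1 + δ k ω)) * δ a ω) μ :=
      hGi.mul_bdd (c := u) (h.measurable a).aestronglyMeasurable
        (ae_of_all _ (fun ω => by rw [Real.norm_eq_abs]; exact h.bounded a ω))
    have hzero : ∫ ω, (F (fun i => δ i ω) * ∏ k ∈ s, (1 + δ k ω)) * δ a ω ∂μ = 0 := by
      have key := integral_pastFn_mul_eq_zero h hu a (F := fun v => F v * ∏ k ∈ s, (1 + v k))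
        ?_ ?_ ?_
      · simpa using key
      · exact hF.mul (Finset.measurable_prod s (fun k _ => (measurable_pi_apply k).const_add 1))
      · intro v w hvw
        have hF' : F v = F w := hdep (fun j hj => hvw j (Set.mem_Iio.mpr
          (lt_of_lt_of_le (Set.mem_Iio.mp hj) hma)))
        have hP' : ∏ k ∈ s, (1 + v k) = ∏ k ∈ s, (1 + w k) :=
          Finset.prod_congr rfl (fun k hk => by rw [hvw k (Set.mem_Iio.mpr (hlt k hk))])
        simp only [hF', hP']
      · refine ⟨C * (1 + u) ^ s.card, fun v hv => ?_⟩
        rw [abs_mul]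
        exact mul_le_mul (hC v hv) (abs_prod_one_add_le s hv) (abs_nonneg _)
          ((abs_nonneg _).trans (hC v hv))
    rw [integral_add hGi hGδ, hzero, add_zero, ih hKs]

/-- **LEMMA 4.12 as the case `F ≡ 1` of Lemma 4.14:** `E ∏_{k∈K}(1+δₖ) = 1` (also the tree's
`productMeanOne_holds`). [cite: ConnollyHighamMary2021, Lemma 4.12 / Lemma 4.14] -/
theorem integral_prod_eq_one [IsProbabilityMeasure μ] (h : SRErrorModel μ u δ) (K : Finset ℕ) :
    ∫ ω, ∏ k ∈ K, (1 + δ k ω) ∂μ = 1 :=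
  productMeanOne_holds Ω μ u δ h K

/-! ### §7 Theorem 4.15 — substitution under stochastic rounding is unbiased -/

/-- **THEOREM 4.15, the source's argument in general form.** Let the computed unknowns of a
triangular solve be bounded measurable functionals `X j` of the SR errors, `X j` depending only on the
errors with index `< D j` (the set `S_j` of the source), and suppose that, as standard backward error
analysis gives in any order of evaluation (eq. (4.14)),
`tᵢᵢ x̂ᵢ = bᵢ∏_{k∈Kᵢ}(1+δₖ) − Σ_{j<i} tᵢⱼ x̂ⱼ ∏_{k∈Kᵢⱼ}(1+δₖ)` where the errors in `Kᵢⱼ` occur later than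
those `x̂ⱼ` depends on (`k ≥ D j`). Then, with `tᵢᵢ ≠ 0`, `E(x̂ᵢ) = xᵢ` for every `i`, `x` being the
solution of the triangular system `tᵢᵢxᵢ = bᵢ − Σ_{j<i} tᵢⱼxⱼ` — by strong induction, Lemma 4.12 for the
first product and Lemma 4.14 (conditioning on `S_j`) for the others.
[cite: ConnollyHighamMary2021, Thm. 4.15] -/
theorem integral_subst_eq [IsProbabilityMeasure μ] (h : SRErrorModel μ u δ)
    (T : ℕ → ℕ → ℝ) (b : ℕ → ℝ) (hT : ∀ i, T i i ≠ 0)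
    (X : ℕ → (ℕ → ℝ) → ℝ) (D : ℕ → ℕ) (hXm : ∀ j, Measurable (X j))
    (hXdep : ∀ j, DependsOn (X j) (Set.Iio (D j)))
    (hXbd : ∀ j, ∃ C, ∀ v : ℕ → ℝ, (∀ t, |v t| ≤ u) → |X j v| ≤ C)
    (Kd : ℕ → Finset ℕ) (Ko : ℕ → ℕ → Finset ℕ) (hKo : ∀ i j, j < i → ∀ k ∈ Ko i j, D j ≤ k)
    (hrec : ∀ i ω, T i i * X i (fun t => δ t ω) = b i * ∏ k ∈ Kd i, (1 + δ k ω)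
      - ∑ j ∈ range i, T i j * X j (fun t => δ t ω) * ∏ k ∈ Ko i j, (1 + δ k ω))
    (x : ℕ → ℝ) (hx : ∀ i, T i i * x i = b i - ∑ j ∈ range i, T i j * x j) :
    ∀ i, ∫ ω, X i (fun t => δ t ω) ∂μ = x i := by
  have hu : 0 ≤ u := u_nonneg h
  intro i
  induction i using Nat.strong_induction_on with
  | _ i ih =>
    -- integrability of the pieces
    have hXω : ∀ j, Measurable (fun ω => X j (fun t => δ t ω)) :=
      fun j => (hXm j).comp (measurable_pi_lambda _ (fun t => h.measurable t))
    have hXPi : ∀ j (K : Finset ℕ),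
        Integrable (fun ω => T i j * X j (fun t => δ t ω) * ∏ k ∈ K, (1 + δ k ω)) μ := by
      intro j K
      obtain ⟨C, hC⟩ := hXbd j
      refine integrable_of_abs_le (((hXω j).const_mul (T i j)).mul
        (Finset.measurable_prod K (fun k _ => (h.measurable k).const_add 1)))
        (C := |T i j| * C * (1 + u) ^ K.card) (fun ω => ?_)
      rw [abs_mul, abs_mul]
      have h1 := hC _ (fun t => h.bounded t ω)
      have h2 := abs_prod_one_add_le K (fun t => h.bounded t ω)
      have h3 : 0 ≤ C := (abs_nonneg _).trans h1
      exact mul_le_mul (mul_le_mul_of_nonneg_left h1 (abs_nonneg _)) h2 (abs_nonneg _)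
        (mul_nonneg (abs_nonneg _) h3)
    -- take means in (4.14)
    have hmean : T i i * ∫ ω, X i (fun t => δ t ω) ∂μ
        = b i * 1 - ∑ j ∈ range i, T i j * x j := by
      rw [← integral_const_mul]
      simp_rw [hrec i]
      rw [integral_sub ((integrable_of_abs_le (Finset.measurable_prod (Kd i)
          (fun k _ => (h.measurable k).const_add 1))
          (fun ω => abs_prod_one_add_le (Kd i) (fun t => h.bounded t ω))).const_mul (b i))
        (integrable_finsetSum _ (fun j _ => hXPi j (Ko i j))),
        integral_const_mul, integral_prod_eq_one h (Kd i),
        integral_finsetSum _ (fun j _ => hXPi j (Ko i j))]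
      congr 1
      refine Finset.sum_congr rfl (fun j hj => ?_)
      have hji : j < i := Finset.mem_range.mp hj
      simp_rw [mul_assoc]
      rw [integral_const_mul, integral_pastFn_mul_prod_eq h hu (hXm j) (hXdep j) (hXbd j) (Ko i j)
        (hKo i j hji), ih j hji]
    rw [mul_one, ← hx i] at hmean
    exact mul_left_cancel₀ (hT i) hmean

end Model

/-! ### §7, concrete instance: forward substitution in the natural order -/

/-- Row `i` (from `0`) of forward substitution for a lower triangular system `Tx = b` in the natural
order under SR, as a function of the error sequence `e` and of the previously computed unknowns
`xp 0, …, xp (i−1)`: the partial results `s₀ = bᵢ`, `s_{j+1} = (s_j ⊖ (tᵢⱼ ⊗ x̂ⱼ))`, the multiplication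
carrying the error of index `i² + 2j` and the subtraction that of index `i² + 2j + 1` (row `i` owns the
`2i + 1` consecutive indices `i², …, i² + 2i`, so earlier rows own smaller indices).
[cite: ConnollyHighamMary2021, Thm. 4.15 proof (eq. (4.13), "2i − 1 rounding errors")] -/
def substPartial (T : ℕ → ℕ → ℝ) (b : ℕ → ℝ) (e : ℕ → ℝ) (i : ℕ) (xp : ℕ → ℝ) : ℕ → ℝ
  | 0 => b i
  | j + 1 => (substPartial T b e i xp j - T i j * xp j * (1 + e (i ^ 2 + 2 * j)))
      * (1 + e (i ^ 2 + 2 * j + 1))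

/-- `x̂ᵢ = (sᵢ ⊘ tᵢᵢ)`, the division carrying the error of index `i² + 2i`.
[cite: ConnollyHighamMary2021, Thm. 4.15 proof (eq. (4.13))] -/
noncomputable def substRow (T : ℕ → ℕ → ℝ) (b : ℕ → ℝ) (e : ℕ → ℝ) (i : ℕ) (xp : ℕ → ℝ) : ℝ :=
  substPartial T b e i xp i / T i i * (1 + e (i ^ 2 + 2 * i))

/-- The computed unknowns of the first `i` rows, `(x̂₀, …, x̂_{i−1}, 0, 0, …)`.
[cite: ConnollyHighamMary2021, Thm. 4.15 proof] -/
noncomputable def substVec (T : ℕ → ℕ → ℝ) (b : ℕ → ℝ) (e : ℕ → ℝ) : ℕ → ℕ → ℝ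
  | 0 => fun _ => 0
  | i + 1 => fun j => if j < i then substVec T b e i j
      else if j = i then substRow T b e i (substVec T b e i) else 0

/-- **The computed solution `x̂` of the lower triangular system `Tx = b` by forward substitution in
the natural order under stochastic rounding**, one rounding error per operation, as a function of the
error sequence `e` (`e ≡ 0` gives exact substitution). [cite: ConnollyHighamMary2021, Thm. 4.15] -/
noncomputable def substSol (T : ℕ → ℕ → ℝ) (b : ℕ → ℝ) (e : ℕ → ℝ) (i : ℕ) : ℝ :=
  substRow T b e i (substVec T b e i)

/-- [folklore] the stored unknowns are the computed ones. -/
private theorem substVec_eq (T : ℕ → ℕ → ℝ) (b : ℕ → ℝ) (e : ℕ → ℝ) :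
    ∀ i j, j < i → substVec T b e i j = substSol T b e j := by
  intro i
  induction i with
  | zero => intro j hj; omega
  | succ i ih =>
    intro j hj
    by_cases hji : j < i
    · simp only [substVec, hji, if_true]
      exact ih j hji
    · have hj' : j = i := by omega
      subst hj'
      simp only [substVec, lt_irrefl, if_false, if_true, substSol]

/-- [folklore] `s_j` only reads `x̂₀, …, x̂_{j−1}`. -/
private theorem substPartial_congr (T : ℕ → ℕ → ℝ) (b : ℕ → ℝ) (e : ℕ → ℝ) (i : ℕ) {xp xp' : ℕ → ℝ} :
    ∀ j, (∀ l < j, xp l = xp' l) → substPartial T b e i xp j = substPartial T b e i xp' j := by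
  intro j
  induction j with
  | zero => intro _; rfl
  | succ j ih =>
    intro hl
    simp only [substPartial]
    rw [ih (fun l hl' => hl l (by omega)), hl j (by omega)]

/-- **The algebra of row `i`:** `s_j = bᵢ∏_{l<j}(1+σ_l) − Σ_{j'<j} tᵢⱼ' x̂ⱼ' (1+π_{j'})∏_{j'≤l<j}(1+σ_l)`
(`π_l = e(i²+2l)`, `σ_l = e(i²+2l+1)`). [cite: ConnollyHighamMary2021, Thm. 4.15 proof (display before
(4.14))] -/
theorem substPartial_eq (T : ℕ → ℕ → ℝ) (b : ℕ → ℝ) (e : ℕ → ℝ) (i : ℕ) (xp : ℕ → ℝ) :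
    ∀ j, substPartial T b e i xp j = b i * ∏ l ∈ range j, (1 + e (i ^ 2 + 2 * l + 1))
      - ∑ j' ∈ range j, T i j' * xp j' *
          ((1 + e (i ^ 2 + 2 * j')) * ∏ l ∈ Ico j' j, (1 + e (i ^ 2 + 2 * l + 1))) := by
  intro j
  induction j with
  | zero => simp [substPartial]
  | succ j ih =>
    simp only [substPartial]
    rw [ih, Finset.prod_range_succ, Finset.sum_range_succ, Nat.Ico_succ_singleton,
      Finset.prod_singleton]
    have hS : ∑ j' ∈ range j, T i j' * xp j' *
          ((1 + e (i ^ 2 + 2 * j')) * ∏ l ∈ Ico j' (j + 1), (1 + e (i ^ 2 + 2 * l + 1)))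
        = (∑ j' ∈ range j, T i j' * xp j' *
          ((1 + e (i ^ 2 + 2 * j')) * ∏ l ∈ Ico j' j, (1 + e (i ^ 2 + 2 * l + 1))))
          * (1 + e (i ^ 2 + 2 * j + 1)) := by
      rw [Finset.sum_mul]
      refine Finset.sum_congr rfl (fun j' hj' => ?_)
      rw [Finset.prod_Ico_succ_top (by have := Finset.mem_range.mp hj'; omega)]
      ring
    rw [hS]
    ring

/-- The error indices met by the `bᵢ` term of row `i`: the subtractions `i²+2l+1`, `l < i`, and the
division `i²+2i`. [cite: ConnollyHighamMary2021, Thm. 4.15 proof (`δ⁽ⁱ⁾_{i,k}`)] -/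
def substKd (i : ℕ) : Finset ℕ := insert (i ^ 2 + 2 * i) ((range i).image (fun l => i ^ 2 + 2 * l + 1))

/-- The error indices met by the `tᵢⱼx̂ⱼ` term of row `i` (`j < i`): the multiplication `i²+2j`, the
subtractions `i²+2l+1`, `j ≤ l < i`, and the division `i²+2i`.
[cite: ConnollyHighamMary2021, Thm. 4.15 proof (`δ⁽ⁱ⁾_{j,k}`)] -/
def substKo (i j : ℕ) : Finset ℕ :=
  insert (i ^ 2 + 2 * i) (insert (i ^ 2 + 2 * j) ((Ico j i).image (fun l => i ^ 2 + 2 * l + 1)))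

/-- [folklore] product over `substKd i`. -/
private theorem prod_substKd (i : ℕ) (f : ℕ → ℝ) :
    ∏ k ∈ substKd i, f k = (∏ l ∈ range i, f (i ^ 2 + 2 * l + 1)) * f (i ^ 2 + 2 * i) := by
  unfold substKd
  rw [Finset.prod_insert, Finset.prod_image, mul_comm]
  · intro l _ l' _ hll'
    simp only at hll'
    omega
  · intro hmem
    obtain ⟨l, hl, hl'⟩ := Finset.mem_image.mp hmem
    omega

/-- [folklore] product over `substKo i j`. -/
private theorem prod_substKo {i j : ℕ} (hji : j < i) (f : ℕ → ℝ) :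
    ∏ k ∈ substKo i j, f k
      = f (i ^ 2 + 2 * j) * (∏ l ∈ Ico j i, f (i ^ 2 + 2 * l + 1)) * f (i ^ 2 + 2 * i) := by
  unfold substKo
  rw [Finset.prod_insert, Finset.prod_insert, Finset.prod_image]
  · ring
  · intro l _ l' _ hll'
    simp only at hll'
    omega
  · intro hmem
    obtain ⟨l, hl, hl'⟩ := Finset.mem_image.mp hmem
    omega
  · intro hmem
    rcases Finset.mem_insert.mp hmem with h1 | h2
    · omega
    · obtain ⟨l, hl, hl'⟩ := Finset.mem_image.mp h2
      omega

/-- Every error index in `K_{ij}` belongs to row `i`, hence exceeds every index `x̂ⱼ` depends on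
(`≥ i² ≥ (j+1)²`): "the rounding errors `δ⁽ⁱ⁾_{j,k}` occur later than the rounding errors … in `S_j`
for all `j < i`". [cite: ConnollyHighamMary2021, Thm. 4.15 proof] -/
theorem le_of_mem_substKo {i j k : ℕ} (hji : j < i) (hk : k ∈ substKo i j) : (j + 1) ^ 2 ≤ k := by
  have hij : (j + 1) ^ 2 ≤ i ^ 2 := Nat.pow_le_pow_left (by omega) 2
  unfold substKo at hk
  rcases Finset.mem_insert.mp hk with h1 | h1
  · omega
  rcases Finset.mem_insert.mp h1 with h2 | h2
  · omega
  obtain ⟨l, _, hl'⟩ := Finset.mem_image.mp h2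
  omega

/-- **Eq. (4.14) before taking means, for forward substitution in the natural order:**
`tᵢᵢx̂ᵢ = bᵢ∏_{k∈K_{ii}}(1+e_k) − Σ_{j<i} tᵢⱼx̂ⱼ∏_{k∈K_{ij}}(1+e_k)`.
[cite: ConnollyHighamMary2021, Thm. 4.15 proof (display before (4.14))] -/
theorem substSol_rec (T : ℕ → ℕ → ℝ) (b : ℕ → ℝ) (hT : ∀ i, T i i ≠ 0) (e : ℕ → ℝ) (i : ℕ) :
    T i i * substSol T b e i = b i * ∏ k ∈ substKd i, (1 + e k)
      - ∑ j ∈ range i, T i j * substSol T b e j * ∏ k ∈ substKo i j, (1 + e k) := by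
  have h0 : substSol T b e i = substPartial T b e i (substVec T b e i) i / T i i
      * (1 + e (i ^ 2 + 2 * i)) := rfl
  have h1 : substPartial T b e i (substVec T b e i) i = substPartial T b e i (substSol T b e) i :=
    substPartial_congr T b e i i (fun l hl => substVec_eq T b e i l hl)
  have hTi : T i i ≠ 0 := hT i
  have h3 : ∀ A B : ℝ, T i i * (A / T i i * B) = A * B := fun A B => by
    field_simp
  rw [h0, h1, h3, substPartial_eq, prod_substKd]
  have h2 : ∀ j ∈ range i, T i j * substSol T b e j * ∏ k ∈ substKo i j, (1 + e k)
      = T i j * substSol T b e j * ((1 + e (i ^ 2 + 2 * j))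
          * ∏ l ∈ Ico j i, (1 + e (i ^ 2 + 2 * l + 1))) * (1 + e (i ^ 2 + 2 * i)) := by
    intro j hj
    rw [prod_substKo (Finset.mem_range.mp hj)]
    ring
  rw [Finset.sum_congr rfl h2, ← Finset.sum_mul]
  ring

/-- **Exact substitution solves the system:** with `e ≡ 0`, `tᵢᵢxᵢ = bᵢ − Σ_{j<i} tᵢⱼxⱼ`.
[cite: ConnollyHighamMary2021, Thm. 4.15 (eq. (4.13))] -/
theorem substSol_exact (T : ℕ → ℕ → ℝ) (b : ℕ → ℝ) (hT : ∀ i, T i i ≠ 0) (i : ℕ) :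
    T i i * substSol T b (fun _ => 0) i = b i - ∑ j ∈ range i, T i j * substSol T b (fun _ => 0) j := by
  have := substSol_rec T b hT (fun _ => 0) i
  simpa using this

/-! Measurability, dependence on the past only, and boundedness of the computed unknowns as
functionals of the error sequence (the hypotheses of `integral_subst_eq`). -/

/-- [folklore] `s_j` is a measurable functional of the errors if the `x̂ₗ` are. -/
private theorem measurable_substPartial (T : ℕ → ℕ → ℝ) (b : ℕ → ℝ) (i : ℕ) {xp : (ℕ → ℝ) → ℕ → ℝ}
    (hxp : ∀ l, Measurable (fun v => xp v l)) :
    ∀ j, Measurable (fun v : ℕ → ℝ => substPartial T b v i (xp v) j) := by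
  intro j
  induction j with
  | zero => simp only [substPartial]; exact measurable_const
  | succ j ih =>
    simp only [substPartial]
    exact (ih.sub (((hxp j).const_mul _).mul ((measurable_pi_apply _).const_add 1))).mul
      ((measurable_pi_apply _).const_add 1)

/-- [folklore] the stored unknowns are measurable functionals of the errors. -/
private theorem measurable_substVec (T : ℕ → ℕ → ℝ) (b : ℕ → ℝ) :
    ∀ i j, Measurable (fun v : ℕ → ℝ => substVec T b v i j) := by
  intro i
  induction i with
  | zero => intro j; simp only [substVec]; exact measurable_const
  | succ i ih =>
    intro j
    by_cases hji : j < i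
    · simp only [substVec, hji, if_true]; exact ih j
    · by_cases hj : j = i
      · subst hj
        simp only [substVec, lt_irrefl, if_false, if_true, substRow]
        exact ((measurable_substPartial T b j ih j).div_const _).mul
          ((measurable_pi_apply _).const_add 1)
      · simp only [substVec, hji, hj, if_false]; exact measurable_const

/-- `x̂ᵢ` is a measurable functional of the rounding errors. [cite: ConnollyHighamMary2021, Thm. 4.15
proof ("`x̂ⱼ` … depends on the previous rounding errors, which are random")] -/
theorem measurable_substSol (T : ℕ → ℕ → ℝ) (b : ℕ → ℝ) (i : ℕ) :
    Measurable (fun v : ℕ → ℝ => substSol T b v i) := by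
  unfold substSol substRow
  exact ((measurable_substPartial T b i (measurable_substVec T b i) i).div_const _).mul
    ((measurable_pi_apply _).const_add 1)

/-- [folklore] `s_j` depends only on the coordinates in `S` if the `x̂ₗ` do and row `i`'s indices lie
in `S`. -/
private theorem dependsOn_substPartial (T : ℕ → ℕ → ℝ) (b : ℕ → ℝ) (i : ℕ) {xp : (ℕ → ℝ) → ℕ → ℝ}
    {S : Set ℕ} (hxp : ∀ l, DependsOn (fun v => xp v l) S)
    (hS : ∀ l < i, i ^ 2 + 2 * l ∈ S ∧ i ^ 2 + 2 * l + 1 ∈ S) :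
    ∀ j ≤ i, DependsOn (fun v : ℕ → ℝ => substPartial T b v i (xp v) j) S := by
  intro j
  induction j with
  | zero => intro _ v w _; rfl
  | succ j ih =>
    intro hj v w hvw
    have h1 := ih (by omega) hvw
    have h2 := hxp j hvw
    simp only at h1 h2
    simp only [substPartial]
    rw [h1, h2, hvw _ (hS j (by omega)).1, hvw _ (hS j (by omega)).2]

/-- [folklore] the unknowns of the first `i` rows depend only on the errors of index `< i²`. -/
private theorem dependsOn_substVec (T : ℕ → ℕ → ℝ) (b : ℕ → ℝ) :
    ∀ i j, DependsOn (fun v : ℕ → ℝ => substVec T b v i j) (Set.Iio (i ^ 2)) := by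
  intro i
  induction i with
  | zero => intro j v w _; rfl
  | succ i ih =>
    intro j
    have hsub : Set.Iio (i ^ 2) ⊆ Set.Iio ((i + 1) ^ 2) :=
      Set.Iio_subset_Iio (Nat.pow_le_pow_left (by omega) 2)
    by_cases hji : j < i
    · intro v w hvw
      simp only [substVec, hji, if_true]
      exact (ih j).mono hsub hvw
    · by_cases hj : j = i
      · subst hj
        intro v w hvw
        simp only [substVec, lt_irrefl, if_false, if_true, substRow]
        have h1 := dependsOn_substPartial T b j (fun l => (ih l).mono hsub)
          (fun l hl => ⟨Set.mem_Iio.mpr (by nlinarith), Set.mem_Iio.mpr (by nlinarith)⟩) j le_rfl hvw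
        simp only at h1
        rw [h1, hvw _ (Set.mem_Iio.mpr (by nlinarith))]
      · intro v w _
        simp only [substVec, hji, hj, if_false]

/-- `x̂ᵢ` depends only on the rounding errors of rows `0, …, i`, i.e. of index `< (i+1)²` — the set
`Sᵢ` of the source. [cite: ConnollyHighamMary2021, Thm. 4.15 proof (definition of `S_j`)] -/
theorem dependsOn_substSol (T : ℕ → ℕ → ℝ) (b : ℕ → ℝ) (i : ℕ) :
    DependsOn (fun v : ℕ → ℝ => substSol T b v i) (Set.Iio ((i + 1) ^ 2)) := by
  intro v w hvw
  have := dependsOn_substVec T b (i + 1) i hvw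
  simp only [substVec, lt_irrefl, if_false, if_true] at this
  exact this

/-- [folklore] `s_j` is bounded on the cube `|e_t| ≤ u` if the `x̂ₗ` are. -/
private theorem bounded_substPartial (T : ℕ → ℕ → ℝ) (b : ℕ → ℝ) (u : ℝ) (i : ℕ) {xp : (ℕ → ℝ) → ℕ → ℝ}
    (hxp : ∀ l, ∃ C, ∀ v : ℕ → ℝ, (∀ t, |v t| ≤ u) → |xp v l| ≤ C) :
    ∀ j, ∃ C, ∀ v : ℕ → ℝ, (∀ t, |v t| ≤ u) → |substPartial T b v i (xp v) j| ≤ C := by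
  intro j
  induction j with
  | zero => exact ⟨|b i|, fun v _ => by simp [substPartial]⟩
  | succ j ih =>
    obtain ⟨C₁, hC₁⟩ := ih
    obtain ⟨C₂, hC₂⟩ := hxp j
    refine ⟨(C₁ + |T i j| * C₂ * (1 + |u|)) * (1 + |u|), fun v hv => ?_⟩
    simp only [substPartial]
    have hv1 : |1 + v (i ^ 2 + 2 * j)| ≤ 1 + |u| :=
      (abs_add_le _ _).trans (by rw [abs_one]; linarith [hv (i ^ 2 + 2 * j), le_abs_self u])
    have hv2 : |1 + v (i ^ 2 + 2 * j + 1)| ≤ 1 + |u| :=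
      (abs_add_le _ _).trans (by rw [abs_one]; linarith [hv (i ^ 2 + 2 * j + 1), le_abs_self u])
    have hA : |substPartial T b v i (xp v) j - T i j * xp v j * (1 + v (i ^ 2 + 2 * j))|
        ≤ C₁ + |T i j| * C₂ * (1 + |u|) := by
      refine (abs_sub _ _).trans (add_le_add (hC₁ v hv) ?_)
      rw [abs_mul, abs_mul]
      have hC2 : 0 ≤ C₂ := (abs_nonneg _).trans (hC₂ v hv)
      exact mul_le_mul (mul_le_mul_of_nonneg_left (hC₂ v hv) (abs_nonneg _)) hv1 (abs_nonneg _)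
        (mul_nonneg (abs_nonneg _) hC2)
    rw [abs_mul]
    have h0 : 0 ≤ C₁ + |T i j| * C₂ * (1 + |u|) := (abs_nonneg _).trans hA
    exact mul_le_mul hA hv2 (abs_nonneg _) h0

/-- [folklore] the stored unknowns are bounded on the cube `|e_t| ≤ u`. -/
private theorem bounded_substVec (T : ℕ → ℕ → ℝ) (b : ℕ → ℝ) (u : ℝ) :
    ∀ i j, ∃ C, ∀ v : ℕ → ℝ, (∀ t, |v t| ≤ u) → |substVec T b v i j| ≤ C := by
  intro i
  induction i with
  | zero => intro j; exact ⟨0, fun v _ => by simp [substVec]⟩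
  | succ i ih =>
    intro j
    by_cases hji : j < i
    · obtain ⟨C, hC⟩ := ih j
      exact ⟨C, fun v hv => by simp only [substVec, hji, if_true]; exact hC v hv⟩
    · by_cases hj : j = i
      · subst hj
        obtain ⟨C, hC⟩ := bounded_substPartial T b u j ih j
        refine ⟨C / |T j j| * (1 + |u|), fun v hv => ?_⟩
        simp only [substVec, lt_irrefl, if_false, if_true, substRow]
        rw [abs_mul, abs_div]
        have hv1 : |1 + v (j ^ 2 + 2 * j)| ≤ 1 + |u| :=
          (abs_add_le _ _).trans (by rw [abs_one]; linarith [hv (j ^ 2 + 2 * j), le_abs_self u])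
        have hC0 : 0 ≤ C := (abs_nonneg _).trans (hC v hv)
        exact mul_le_mul (div_le_div_of_nonneg_right (hC v hv) (abs_nonneg _)) hv1 (abs_nonneg _)
          (div_nonneg hC0 (abs_nonneg _))
      · exact ⟨0, fun v _ => by simp [substVec, hji, hj]⟩

/-- `x̂ᵢ` is bounded when the errors are (`|e_t| ≤ u`), so its mean exists.
[cite: ConnollyHighamMary2021, Thm. 4.15 proof] -/
theorem bounded_substSol (T : ℕ → ℕ → ℝ) (b : ℕ → ℝ) (u : ℝ) (i : ℕ) :
    ∃ C, ∀ v : ℕ → ℝ, (∀ t, |v t| ≤ u) → |substSol T b v i| ≤ C := by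
  obtain ⟨C, hC⟩ := bounded_substVec T b u (i + 1) i
  refine ⟨C, fun v hv => ?_⟩
  have := hC v hv
  simp only [substVec, lt_irrefl, if_false, if_true] at this
  exact this


section Concrete

variable {Ω : Type} [MeasurableSpace Ω] {μ : Measure Ω} {u : ℝ} {δ : ℕ → Ω → ℝ}

/-- **THEOREM 4.15 (forward substitution in the natural order, one SR error per operation).** Let the
lower triangular system `Tx = b` (`tᵢᵢ ≠ 0`) be solved by substitution with stochastic rounding, the
rounding errors following the SR error model. The computed solution satisfies `E(x̂ᵢ) = xᵢ` for every
`i`, where `x = substSol T b 0` is the result of EXACT substitution, i.e. the solution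
(`substSol_exact`). [cite: ConnollyHighamMary2021, Thm. 4.15] -/
theorem integral_substSol_eq [IsProbabilityMeasure μ] (h : SRErrorModel μ u δ) (T : ℕ → ℕ → ℝ)
    (b : ℕ → ℝ) (hT : ∀ i, T i i ≠ 0) (i : ℕ) :
    ∫ ω, substSol T b (fun t => δ t ω) i ∂μ = substSol T b (fun _ => 0) i :=
  integral_subst_eq h T b hT (fun j v => substSol T b v j) (fun j => (j + 1) ^ 2)
    (fun j => measurable_substSol T b j) (fun j => dependsOn_substSol T b j)
    (fun j => bounded_substSol T b u j) substKd substKo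
    (fun _ _ hji _ hk => le_of_mem_substKo hji hk)
    (fun i ω => substSol_rec T b hT (fun t => δ t ω) i)
    (fun j => substSol T b (fun _ => 0) j) (fun i => substSol_exact T b hT i) i

end Concrete

end Literature.ComputerArithmetic.ConnollyHighamMary2021
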